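import Literature.MathematicalPhysics.QuantumFieldTheory.Balaban1983to89.B6Cov2110CombesThomas
import Literature.MathematicalPhysics.QuantumFieldTheory.Balaban1983to89.B6AdmissibleProjectionV1
import Literature.MathematicalPhysics.QuantumFieldTheory.Balaban1983to89.B6Ineq2110TwoScaleV1
import Literature.MathematicalPhysics.QuantumFieldTheory.Balaban1983to89.B6SectCPositivity

/-!
# `Balaban1983to89.B6Cov2110MatrixV1` — T. Bałaban, *Propagators and renormalization transformations for lattice gauge
# theories. II*, Commun. Math. Phys. **96** (1984) 223–250 [Balaban1984PropagatorsII], p. 242 (text after (2.110)): *«… a covariance C^{(j)}_Λ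
# of the last Gaussian integrals in (2.106) is a bounded operator with an exponential decay independent of j and Λ»* — THE CONCRETE `C^{(j)}_Λ` OF
# THE TWO-SCALE DATA `tsV1` MEETS THE HYPOTHESES OF THE COMPRESSED COMBES–THOMAS STEP (`…B6Cov2110CombesThomas`): its kernel decays
# exponentially AS SOON AS the conjugation-error (Schur) bound for the kernel of `Δ′_j` under a block-constant weight is supplied

statement-level skeleton of published theorems with citation tags; proofs where landed; nothing here is a claim about the Yang–Mills mass gap

PDF held: `paper:balaban1984-cmp96-propagators-rt-ii` (journal page = PDF page + 222; p. 242 [PDF 20] read AS IMAGE on the ×2 render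
`run/shared/lean/pub/pub-balaban/b2b-balaban-ref1/pages/1984-cmp96-propagators-rt-II/…-p020-x2.png`, 2026-08-21).

PRINT (verbatim, p. 242).  *"Hence γ₀‖ω‖² ≤ ⟨ω, Δ′_jω⟩ ≤ γ₁‖ω‖² for ω : Q′₁ω = 0, (2.110) with positive constants γ₀, γ₁ dependent on d and L only. From
the theorem on unit lattice operators in [3] it follows that a covariance C^{(j)}_Λ of the last Gaussian integrals in (2.106) is a bounded operator
with an exponential decay independent of j and Λ."*

CITATION HEADER (lean-in-tree rule) — WHAT IS REPRODUCED.  Phase-2 file of the `lit-balaban` typed skeleton (HOME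
`run/shared/lean/pub/lit-balaban/`), seat **p22 gen 11** (B6 fold owner r03, referee ref-4; lane = the Sect. C chain (2.95)–(2.147) on the
concrete two-scale data `tsV1`).  SKELETON row **B6.Eq2.110** (*"(2.110) + C^{(j)}_Λ"*; the «exponential decay» clause).  IMPORTS BY NAME: the same
seat's abstract step `…B6Cov2110CombesThomas.cov_abs_le` (decay of a covariance compressed to `range P` from coercivity `hS` and the
conjugation-error bound `hSe`), `…B6AdmissibleProjectionV1.starProjection_admissible_blockLocal` (the projection onto the admissible `ω` is
block-local), `…B6Ineq2110TwoScaleV1.ineq2110_V1_lower`/`gamma0_V1_pos` ((2.110) for `tsV1`), gen 8's `…B6SectCPositivity.Dp_symm/Dp_pos`,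
`…B6SectCTwoScaleV1Lattice.isLattice/positive`, gen 7's `B6CovarianceOperator.covOp_mem/covOp_sol` (`C^{(j)}_Λ = covOp S₁ Δ′_j`).  THIS FILE:
* §1 (generic, any finite index): the SITE-BASIS MATRIX `M_T(x, x′) = (Te_{x′})(x)` of a linear map `T` of `ℓ²`: `siteMatrix_mulVec` (`M_Tv = T(v)`),
  `dotProduct_siteMatrix_mulVec` (`⟨u, M_Tv⟩ = ⟨u, Tv⟩`), `siteMatrix_isSymm_of_symm`, `siteMatrix_mul` (`M_{T∘U} = M_TM_U`);
* §2 for `tsV1 hc Λ′ w` (`c ≠ 0`, `j + 1 ≤ m + K`, `w > 0`), `S := M_{Δ′_j}`, `P := M_{P_{S₁}}`: `projMatrix_isSymm`, `projMatrix_idem`, `projMatrix_blockConst`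
  (a block function `φ ∘ y` is constant on the blocks of `P`), `DpMatrix_isSymm`, **`DpMatrix_coercive`** (`hS` with `γ₀ = θc₀(d)(8/L²)²` from (2.110)),
  **`cov_column_eq`** (the kernel column `c = C^{(j)}_Λe_{x′}` solves `(PSP + γ₀(1 − P))c = Pe_{x′}`);
* §3 **`cov_kernel_decay_of_herr`**: for every block function `φ` whose conjugation error for `S` on `range P` is `≥ −(γ₀/2)‖·‖²` (`hSe`, the Schur
  bound — NOT proved here), `|⟨e_x, C^{(j)}_Λe_{x′}⟩| ≤ (2/γ₀)·e^{−(φ(y(x)) − φ(y(x′)))}`.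
THEOREMS ONLY (no definition, no `def … : Prop` fact); standard axioms.  HONEST SCOPE: CONDITIONAL on the displayed Schur bound `hSe` for a chosen
weight (successor plan `lit-balaban-p22/GEN12-PLAN.md` item 1 (c)–(d): `φ = δ·`torus distance of block centres, `δ = δ(d, L)`, from r03's entry decay
`norm_dPOp_le` and the uniform torus sum `B5Hk163TorusHolderRate.sum_exp_torusSupNorm_sub_rep_le`); `γ₀` carries the V1 normalisation `θ`; finite
tori of the V1 calculus, centred blocks (`L` odd); NOT summit progress.
-/

noncomputable section

open scoped InnerProductSpace
open Finset Matrix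

namespace Literature.MathematicalPhysics.QuantumFieldTheory.Balaban1983to89.B6Cov2110MatrixV1

open LatticeFieldCalculus B6SectAOperatorsV1 B6SectCTwoScaleV1 B6SectCTwoScaleV1Lattice B6CovarianceOperator
open B6SectCOperators (TwoScaleData)
open B6SectCPositivity (Dp_pos Dp_symm)
open B6Hprime2101 (c0_2109)
open B6Ineq2110TwoScaleV1 (ineq2110_V1_lower gamma0_V1_pos)
open B6AdmissibleProjectionV1 (starProjection_admissible_blockLocal)
open B6Cov2110CombesThomas (cov_abs_le)

/-! ## §1  The site-basis matrix of a linear map of `ℓ²` -/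

section Generic

variable {ι : Type*} [Fintype ι] [DecidableEq ι] (T U : EuclideanSpace ℝ ι →ₗ[ℝ] EuclideanSpace ℝ ι)

/-- `v = Σ_i v_i e_i` in `ℓ²`. [folklore] -/
private theorem toLp_eq_sum (v : ι → ℝ) : WithLp.toLp 2 v = ∑ i, v i • EuclideanSpace.single i (1 : ℝ) := by
  have h := (EuclideanSpace.basisFun ι ℝ).sum_repr (WithLp.toLp 2 v)
  simp only [EuclideanSpace.basisFun_repr, EuclideanSpace.basisFun_apply] at h
  exact h.symm

/-- **`M_Tv = T(v)`**: the site-basis matrix `M_T(x, x′) = (Te_{x′})(x)` acts as `T`. [cite: Balaban1984PropagatorsII, p.242 (text after (2.110))] -/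
theorem siteMatrix_mulVec (v : ι → ℝ) (x : ι) :
    (Matrix.of (fun x x' : ι => T (EuclideanSpace.single x' (1 : ℝ)) x) *ᵥ v) x = T (WithLp.toLp 2 v) x := by
  rw [toLp_eq_sum, map_sum, WithLp.ofLp_sum, Finset.sum_apply]
  simp only [Matrix.mulVec, dotProduct, Matrix.of_apply, map_smul, WithLp.ofLp_smul, Pi.smul_apply, smul_eq_mul]
  exact Finset.sum_congr rfl fun i _ => mul_comm _ _

/-- `⟨u, M_Tv⟩ = ⟨u, Tv⟩_{ℓ²}`. [cite: Balaban1984PropagatorsII, p.242 (text after (2.110))] -/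
theorem dotProduct_siteMatrix_mulVec (u v : ι → ℝ) :
    u ⬝ᵥ Matrix.of (fun x x' : ι => T (EuclideanSpace.single x' (1 : ℝ)) x) *ᵥ v = ⟪WithLp.toLp 2 u, T (WithLp.toLp 2 v)⟫_ℝ := by
  rw [inner_eq_sum]
  simp only [dotProduct, siteMatrix_mulVec]

/-- the entries are the matrix elements `⟨e_x, Te_{x′}⟩`. [cite: Balaban1984PropagatorsII, p.242 (text after (2.110))] -/
theorem siteMatrix_apply_eq_inner (x x' : ι) :
    Matrix.of (fun x x' : ι => T (EuclideanSpace.single x' (1 : ℝ)) x) x x' =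
      ⟪EuclideanSpace.single x (1 : ℝ), T (EuclideanSpace.single x' (1 : ℝ))⟫_ℝ := by
  rw [Matrix.of_apply, EuclideanSpace.inner_single_left, conj_trivial, one_mul]

/-- a symmetric `T` has a symmetric site-basis matrix. [cite: Balaban1984PropagatorsII, p.242 (text after (2.110))] -/
theorem siteMatrix_isSymm_of_symm (hT : ∀ a b : EuclideanSpace ℝ ι, ⟪T a, b⟫_ℝ = ⟪a, T b⟫_ℝ) :
    (Matrix.of (fun x x' : ι => T (EuclideanSpace.single x' (1 : ℝ)) x)).IsSymm := by
  ext x x'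
  rw [Matrix.transpose_apply, siteMatrix_apply_eq_inner, siteMatrix_apply_eq_inner, ← hT, real_inner_comm]

/-- `M_{T∘U} = M_TM_U`. [cite: Balaban1984PropagatorsII, p.242 (text after (2.110))] -/
theorem siteMatrix_mul :
    Matrix.of (fun x x' : ι => T (EuclideanSpace.single x' (1 : ℝ)) x) * Matrix.of (fun x x' : ι => U (EuclideanSpace.single x' (1 : ℝ)) x) =
      Matrix.of (fun x x' : ι => (T ∘ₗ U) (EuclideanSpace.single x' (1 : ℝ)) x) := by
  ext x x'
  have h := siteMatrix_mulVec T (fun z => U (EuclideanSpace.single x' (1 : ℝ)) z) x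
  rw [Matrix.mul_apply]
  simp only [Matrix.mulVec, dotProduct, Matrix.of_apply] at h ⊢
  rw [h, LinearMap.comp_apply]

/-- the compressed operator of `…B6Cov2110CombesThomas` applied to a vector in `range P`: `Pc = c ⇒ (PSP + γ(1 − P))c = P(Sc)`.
[cite: Balaban1984PropagatorsII, p.242 (text after (2.110))] -/
theorem compressed_mulVec_of_proj_eq (Pm S : Matrix ι ι ℝ) (γ : ℝ) (c : ι → ℝ) (hc : Pm *ᵥ c = c) :
    (Pm * S * Pm + γ • (1 - Pm)) *ᵥ c = Pm *ᵥ (S *ᵥ c) := by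
  rw [Matrix.add_mulVec, Matrix.smul_mulVec, Matrix.sub_mulVec, Matrix.one_mulVec, hc, sub_self, smul_zero, add_zero,
    ← Matrix.mulVec_mulVec, ← Matrix.mulVec_mulVec, hc]

end Generic

/-! ## §2  The matrices of `Δ′_j` and of the projection onto the admissible `ω`, for the two-scale data -/

section V1

variable {P : Params} {c : ℝ} (hc : c ≠ 0) {j : ℕ} (hj : j + 1 ≤ P.m + P.K) (Λ' : Finset (Site P (j + 1)))
  {w : CIdx j Λ' → ℝ} (hw : ∀ i, 0 < w i)

/-- the matrix of the projection onto the admissible `ω` is symmetric. [cite: Balaban1984PropagatorsII, (2.104)–(2.106) pp.241–242] -/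
theorem projMatrix_isSymm :
    (Matrix.of (fun x x' : Site P j => (admissible P j Λ').starProjection (EuclideanSpace.single x' (1 : ℝ)) x)).IsSymm :=
  siteMatrix_isSymm_of_symm ((admissible P j Λ').starProjection : USite P j →ₗ[ℝ] USite P j)
    fun a b => Submodule.inner_starProjection_left_eq_right (admissible P j Λ') a b

/-- … and idempotent. [cite: Balaban1984PropagatorsII, (2.104)–(2.106) pp.241–242] -/
theorem projMatrix_idem :
    Matrix.of (fun x x' : Site P j => (admissible P j Λ').starProjection (EuclideanSpace.single x' (1 : ℝ)) x) *
        Matrix.of (fun x x' : Site P j => (admissible P j Λ').starProjection (EuclideanSpace.single x' (1 : ℝ)) x) =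
      Matrix.of (fun x x' : Site P j => (admissible P j Λ').starProjection (EuclideanSpace.single x' (1 : ℝ)) x) := by
  have h := siteMatrix_mul ((admissible P j Λ').starProjection : USite P j →ₗ[ℝ] USite P j)
    ((admissible P j Λ').starProjection : USite P j →ₗ[ℝ] USite P j)
  simp only [ContinuousLinearMap.coe_coe] at h
  rw [h]
  ext x x'
  simp only [Matrix.of_apply, LinearMap.comp_apply, ContinuousLinearMap.coe_coe]
  rw [Submodule.starProjection_eq_self_iff.mpr (Submodule.starProjection_apply_mem _ _)]

include hj in
/-- **block functions are constant on the blocks of `P`**: `P(x, x′) ≠ 0 ⇒ φ(y(x)) = φ(y(x′))` (block-locality of the projection).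
[cite: Balaban1984PropagatorsII, (2.104)–(2.106) pp.241–242] -/
theorem projMatrix_blockConst (φ : Site P (j + 1) → ℝ) (x x' : Site P j)
    (h : Matrix.of (fun x x' : Site P j => (admissible P j Λ').starProjection (EuclideanSpace.single x' (1 : ℝ)) x) x x' ≠ 0) :
    φ (blockOf x) = φ (blockOf x') := by
  rw [Matrix.of_apply] at h
  rw [(starProjection_admissible_blockLocal hj Λ' h).2]

include hj hw in
/-- the matrix of `Δ′_j` is symmetric. [cite: Balaban1984PropagatorsII, (2.107) p.242] -/
theorem DpMatrix_isSymm : (Matrix.of (fun x x' : Site P j => (tsV1 hc Λ' w).Dp (EuclideanSpace.single x' (1 : ℝ)) x)).IsSymm :=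
  siteMatrix_isSymm_of_symm _ (Dp_symm (isLattice Λ' hc hj hw))

/-- `P_{S₁}(v) ∈ S₁` read through the matrices: `toLp (Pv)` is admissible. [cite: Balaban1984PropagatorsII, (2.104)–(2.106) pp.241–242] -/
theorem toLp_projMatrix_mulVec (v : Site P j → ℝ) :
    WithLp.toLp 2 (Matrix.of (fun x x' : Site P j => (admissible P j Λ').starProjection (EuclideanSpace.single x' (1 : ℝ)) x) *ᵥ v) =
      (admissible P j Λ').starProjection (WithLp.toLp 2 v) := by
  ext x
  rw [PiLp.toLp_apply]
  exact siteMatrix_mulVec ((admissible P j Λ').starProjection : USite P j →ₗ[ℝ] USite P j) v x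

include hj in
/-- **COERCIVITY ON `range P`** (hypothesis `hS` of the abstract step): `γ₀‖Pu‖² ≤ ⟨Pu, S(Pu)⟩` with `γ₀ = θ·c₀(d)(8/L²)²`, from (2.110) for the
two-scale data (`Pu` is admissible). [cite: Balaban1984PropagatorsII, (2.110) p.242] -/
theorem DpMatrix_coercive (u : Site P j → ℝ) :
    (c / (P.L : ℝ) ^ j) ^ 4 * ((P.L : ℝ) ^ j) ^ P.d * (c0_2109 P.d * (8 / (P.L : ℝ) ^ 2) ^ 2) *
        (Matrix.of (fun x x' : Site P j => (admissible P j Λ').starProjection (EuclideanSpace.single x' (1 : ℝ)) x) *ᵥ u ⬝ᵥ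
          Matrix.of (fun x x' : Site P j => (admissible P j Λ').starProjection (EuclideanSpace.single x' (1 : ℝ)) x) *ᵥ u) ≤
      Matrix.of (fun x x' : Site P j => (admissible P j Λ').starProjection (EuclideanSpace.single x' (1 : ℝ)) x) *ᵥ u ⬝ᵥ
        Matrix.of (fun x x' : Site P j => (tsV1 hc Λ' w).Dp (EuclideanSpace.single x' (1 : ℝ)) x) *ᵥ
          (Matrix.of (fun x x' : Site P j => (admissible P j Λ').starProjection (EuclideanSpace.single x' (1 : ℝ)) x) *ᵥ u) := by
  set k := Matrix.of (fun x x' : Site P j => (admissible P j Λ').starProjection (EuclideanSpace.single x' (1 : ℝ)) x) *ᵥ u with hk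
  have hmem : WithLp.toLp 2 k ∈ admissible P j Λ' := by
    rw [hk, toLp_projMatrix_mulVec]
    exact Submodule.starProjection_apply_mem _ _
  have h := ineq2110_V1_lower hc Λ' w hj (WithLp.toLp 2 k) hmem
  have hnorm : ‖WithLp.toLp 2 k‖ ^ 2 = k ⬝ᵥ k := by
    rw [← real_inner_self_eq_norm_sq, inner_eq_sum]
    rfl
  rw [dotProduct_siteMatrix_mulVec, ← hnorm]
  exact h

include hj hw in
/-- **THE KERNEL COLUMN OF `C^{(j)}_Λ` SOLVES THE COMPRESSED EQUATION**: `c = C^{(j)}_Λe_{x′}` satisfies `(PSP + γ(1 − P))c = Pe_{x′}` for every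
`γ` (`c ∈ S₁`: gen 7's `covOp_mem`; `PSc = Pe_{x′}`: `covOp_sol`). [cite: Balaban1984PropagatorsII, (2.106)–(2.110) p.242] -/
theorem cov_column_eq (γ : ℝ) (x' : Site P j) :
    (Matrix.of (fun x x' : Site P j => (admissible P j Λ').starProjection (EuclideanSpace.single x' (1 : ℝ)) x) *
          Matrix.of (fun x x' : Site P j => (tsV1 hc Λ' w).Dp (EuclideanSpace.single x' (1 : ℝ)) x) *
          Matrix.of (fun x x' : Site P j => (admissible P j Λ').starProjection (EuclideanSpace.single x' (1 : ℝ)) x) +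
        γ • (1 - Matrix.of (fun x x' : Site P j => (admissible P j Λ').starProjection (EuclideanSpace.single x' (1 : ℝ)) x))) *ᵥ
        (fun x => (tsV1 hc Λ' w).C (EuclideanSpace.single x' (1 : ℝ)) x) =
      Matrix.of (fun x x' : Site P j => (admissible P j Λ').starProjection (EuclideanSpace.single x' (1 : ℝ)) x) *ᵥ Pi.single x' 1 := by
  set Cv := (tsV1 hc Λ' w).C (EuclideanSpace.single x' (1 : ℝ)) with hCv
  have hCmem : Cv ∈ admissible P j Λ' := covOp_mem _ _ _
  have hPl : ∀ v : Site P j → ℝ, Matrix.of (fun x x' : Site P j => (admissible P j Λ').starProjection (EuclideanSpace.single x' (1 : ℝ)) x) *ᵥ v =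
      WithLp.ofLp ((admissible P j Λ').starProjection (WithLp.toLp 2 v)) := fun v => by
    funext x
    exact siteMatrix_mulVec ((admissible P j Λ').starProjection : USite P j →ₗ[ℝ] USite P j) v x
  have hDl : ∀ v : Site P j → ℝ, Matrix.of (fun x x' : Site P j => (tsV1 hc Λ' w).Dp (EuclideanSpace.single x' (1 : ℝ)) x) *ᵥ v =
      WithLp.ofLp ((tsV1 hc Λ' w).Dp (WithLp.toLp 2 v)) := fun v => by
    funext x
    exact siteMatrix_mulVec _ v x
  -- `Pc = c`
  have h1 : Matrix.of (fun x x' : Site P j => (admissible P j Λ').starProjection (EuclideanSpace.single x' (1 : ℝ)) x) *ᵥ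
      (fun x => Cv x) = fun x => Cv x := by
    rw [hPl]
    show WithLp.ofLp ((admissible P j Λ').starProjection (WithLp.toLp 2 (WithLp.ofLp Cv))) = WithLp.ofLp Cv
    rw [WithLp.toLp_ofLp, Submodule.starProjection_eq_self_iff.mpr hCmem]
  rw [compressed_mulVec_of_proj_eq _ _ γ _ h1]
  -- `P(Sc) = Pe_{x′}`: `Sc − e_{x′} ⊥ S₁`
  have h2 : (tsV1 hc Λ' w).Dp Cv - EuclideanSpace.single x' (1 : ℝ) ∈ (admissible P j Λ')ᗮ := by
    rw [Submodule.mem_orthogonal]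
    intro u hu
    rw [inner_sub_right, sub_eq_zero]
    exact covOp_sol (admissible P j Λ') (tsV1 hc Λ' w).Dp
      (fun k hk => Dp_pos (isLattice Λ' hc hj hw) (positive Λ' hc hj w) k hk) ⟨u, hu⟩ _
  have h3 : (admissible P j Λ').starProjection ((tsV1 hc Λ' w).Dp Cv) =
      (admissible P j Λ').starProjection (EuclideanSpace.single x' (1 : ℝ)) := by
    rw [← sub_eq_zero, ← map_sub, Submodule.starProjection_apply_eq_zero_iff]
    exact h2
  rw [hDl, hPl, hPl, WithLp.toLp_ofLp, PiLp.toLp_single]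
  show WithLp.ofLp ((admissible P j Λ').starProjection ((tsV1 hc Λ' w).Dp (WithLp.toLp 2 (WithLp.ofLp Cv)))) = _
  rw [WithLp.toLp_ofLp, h3]

/-! ## §3  The decay of the kernel of `C^{(j)}_Λ`, conditional on the Schur bound -/

include hj hw in
/-- **EXPONENTIAL DECAY OF THE KERNEL OF `C^{(j)}_Λ` FOR THE TWO-SCALE DATA, GIVEN THE SCHUR BOUND**: for every block function `φ` on `T^{(j+1)}`
such that the conjugation error of the matrix `S` of `Δ′_j` under the weight `φ ∘ y` on `range P` is `≥ −(γ₀/2)‖Pu‖²` (`hSe`; `γ₀ = θc₀(d)(8/L²)²`),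
`|⟨e_x, C^{(j)}_Λe_{x′}⟩| ≤ (2/γ₀)·e^{−(φ(y(x)) − φ(y(x′)))}` — the same seat's `…B6Cov2110CombesThomas.cov_abs_le` with §2.
[cite: Balaban1984PropagatorsII, p.242 (text after (2.110))] -/
theorem cov_kernel_decay_of_herr (φ : Site P (j + 1) → ℝ)
    (hSe : ∀ u : Site P j → ℝ,
      -((c / (P.L : ℝ) ^ j) ^ 4 * ((P.L : ℝ) ^ j) ^ P.d * (c0_2109 P.d * (8 / (P.L : ℝ) ^ 2) ^ 2) / 2) *
          (Matrix.of (fun x x' : Site P j => (admissible P j Λ').starProjection (EuclideanSpace.single x' (1 : ℝ)) x) *ᵥ u ⬝ᵥ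
            Matrix.of (fun x x' : Site P j => (admissible P j Λ').starProjection (EuclideanSpace.single x' (1 : ℝ)) x) *ᵥ u) ≤
        ∑ a, ∑ b, (Real.exp (φ (blockOf a) - φ (blockOf b)) - 1) *
          Matrix.of (fun x x' : Site P j => (tsV1 hc Λ' w).Dp (EuclideanSpace.single x' (1 : ℝ)) x) a b *
            ((Matrix.of (fun x x' : Site P j => (admissible P j Λ').starProjection (EuclideanSpace.single x' (1 : ℝ)) x) *ᵥ u) a *
              (Matrix.of (fun x x' : Site P j => (admissible P j Λ').starProjection (EuclideanSpace.single x' (1 : ℝ)) x) *ᵥ u) b))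
    (x x' : Site P j) :
    |⟪EuclideanSpace.single x (1 : ℝ), (tsV1 hc Λ' w).C (EuclideanSpace.single x' (1 : ℝ))⟫_ℝ| ≤
      2 / ((c / (P.L : ℝ) ^ j) ^ 4 * ((P.L : ℝ) ^ j) ^ P.d * (c0_2109 P.d * (8 / (P.L : ℝ) ^ 2) ^ 2)) *
        Real.exp (-(φ (blockOf x) - φ (blockOf x'))) := by
  have hγ := gamma0_V1_pos (P := P) (j := j) hc
  have h := cov_abs_le
    (Matrix.of (fun x x' : Site P j => (admissible P j Λ').starProjection (EuclideanSpace.single x' (1 : ℝ)) x))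
    (Matrix.of (fun x x' : Site P j => (tsV1 hc Λ' w).Dp (EuclideanSpace.single x' (1 : ℝ)) x))
    ((c / (P.L : ℝ) ^ j) ^ 4 * ((P.L : ℝ) ^ j) ^ P.d * (c0_2109 P.d * (8 / (P.L : ℝ) ^ 2) ^ 2)) (fun z => φ (blockOf z))
    (projMatrix_isSymm Λ') (projMatrix_idem Λ') (fun a b hab => projMatrix_blockConst hj Λ' φ a b hab) hγ
    (DpMatrix_coercive hc hj Λ') hSe x x' (fun z => (tsV1 hc Λ' w).C (EuclideanSpace.single x' (1 : ℝ)) z)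
    (cov_column_eq hc hj Λ' hw _ x')
  rw [EuclideanSpace.inner_single_left, conj_trivial, one_mul]
  exact h

end V1

end Literature.MathematicalPhysics.QuantumFieldTheory.Balaban1983to89.B6Cov2110MatrixV1

end
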